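import Summits.NavierStokesRegularity.NavierStokesRegularity.Theses.AngularGalerkinLadder
import Literature.Analysis.FluidPDE.AncientMildCompactnessForced
import Literature.Analysis.FluidPDE.RotatedDSSWindowExtraction
import Literature.Analysis.FluidPDE.RotatedDSSLimitStructure
import Literature.Analysis.FluidPDE.LocalTypeIBlowup.SingularVertexZoom

/-!
# Route `AngularGalerkinLadder` · K3 `LimitTransfer` FROM ONE ANALYTIC STATEMENT: the forced
# Oseen-mild remainder bound for window profiles

Cell `ns-blowup`, seat `ns-blowup-lean` (g11); `--supports stmt-NavierStokesRegularity-19961`.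
LABEL: KERNEL reduction (sorry-free, CONDITIONAL on the hypothesis `hA` written out below — an
UNREGISTERED analytic statement, LIT-DOSSIER §60 (C2a)+(C2b); the audit will say «credits nothing»).
WHAT THIS IS NOT: not Navier–Stokes evidence and not a closure of any item — it shows that the
parent crux K3 `LimitTransfer` (item 19961) follows from ONE analytic brick about the rung profiles,
with NO pressure bound, NO classical-system clause and NO re-gauging of the limit needed.

## Content

`angularGalerkinLadder_limitTransfer_of_remainder (hA) : Theses.AngularGalerkinLadder.LimitTransfer`,
where `hA` says: for window constants `(C₀, cmin, cmax, δ)` there are `Φ` (monotone, `≥ 0` on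
`(−∞,0)`) and `K` such that every window profile `(u, p, d)` of defect size `ε ≥ 0` satisfies, for all
`s < t < 0`, `x`, the FORCED OSEEN-MILD REMAINDER BOUND
`‖u t x − e^{(t−s)Δ}(u s) x + B¹_s(u,u)(t) x‖ ≤ ε·K s t`, and `≤ ε·Φ t·√(t−s)` when `t − s ≤ 1`.

Proof (all other ingredients are tree theorems): extract the window parameters
(`exists_subseq_window_tendsto`, p477577); run ns-blowup-lit g13's forced KNSS Lemma 6.1
`exists_oseenMild_limit_of_forced` (p479172) along that subsequence with the Type-I profile
`β(τ) = C₀/√(−τ)`, `γ = (sup ε)·Φ` and the remainders as vanishing perturbations — the limit `W` is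
continuous, weakly divergence free, UNFORCED Oseen-mild, and the profiles converge pointwise and
slice-locally-uniformly; cut `W` off to `0` on `t ≥ 0` (`v`); the Type-I weight passes pointwise; `v`
is a Type-I ancient mild field by `LocalTypeIBlowup.isTypeIAncientMild_of_continuous_oseenMild_rate` (KNSS Prop 4.1
smoothing inside), hence ancient mild in duality form (`IsTypeIAncientMild.isAncientMildSolution`);
and `1 < c'`, `IsRotatedDSS c' R' v`, measurability and non-triviality are lit g13's Baire/Osgood
structure theorem `typeI_rotatedDSS_structure_of_tendsto` (p476224).

References: [cite: KochNadirashviliSereginSverak2009, Lemma 6.1 and Prop. 4.1 (arXiv:0709.3599)];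
[cite: ChaeWolf2017, Def. 1.1].
-/

set_option linter.dupNamespace false

namespace Summit.NavierStokesRegularity.NavierStokesRegularity.Theorems

open Set Filter MeasureTheory Topology Function
open Literature.Analysis Literature.Analysis.FluidPDE
open Summit.NavierStokesRegularity.FluidComputer

/-- The Oseen–Duhamel term `B¹_s(a,b)(t)` only sees the fields on `(s, t)`. Private copy of the
tree's `oseenDuhamel_congr`. [folklore] -/
private theorem oseenDuhamel_congr' {ν s t : ℝ}
    {a a' b b' : ℝ → EuclideanSpace ℝ (Fin 3) → EuclideanSpace ℝ (Fin 3)}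
    (ha : ∀ τ ∈ Ioo s t, a τ = a' τ) (hb : ∀ τ ∈ Ioo s t, b τ = b' τ)
    (x : EuclideanSpace ℝ (Fin 3)) :
    oseenDuhamel ν s a b t x = oseenDuhamel ν s a' b' t x := by
  rw [oseenDuhamel_apply, oseenDuhamel_apply]
  refine setIntegral_congr_fun measurableSet_Ioo fun τ hτ => ?_
  simp only [ha τ hτ, hb τ hτ]

/-- The Type-I time profile `τ ↦ C₀/√(−τ)` is monotone on `(−∞, 0)` for `C₀ ≥ 0`. [folklore] -/
private theorem monotoneOn_typeI_profile' {C₀ : ℝ} (hC : 0 ≤ C₀) :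
    MonotoneOn (fun τ : ℝ => C₀ / Real.sqrt (-τ)) (Iio 0) := by
  intro a _ b hb hab
  have hb0 : 0 < Real.sqrt (-b) := Real.sqrt_pos.2 (by simpa using hb)
  exact div_le_div_of_nonneg_left hC hb0 (Real.sqrt_le_sqrt (by linarith))

/-- **K3 `LimitTransfer` from the forced Oseen-mild remainder bound.** If every window profile of
defect size `ε` is forced-Oseen-mild on the past with a remainder `≤ ε·K(s,t)` (all lags) and
`≤ ε·Φ(t)√(t−s)` (lags `≤ 1`), `Φ ≥ 0` monotone on `(−∞,0)`, with `Φ`, `K` depending on the window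
constants only, then the crux `LimitTransfer` of route `AngularGalerkinLadder` holds (module
docstring for the proof route; everything else is in the tree).
[cite: KochNadirashviliSereginSverak2009, Lemma 6.1 and Prop. 4.1 (arXiv:0709.3599)] -/
theorem angularGalerkinLadder_limitTransfer_of_remainder
    (hA : ∀ (C₀ cmin cmax δ : ℝ), ∃ (Φ : ℝ → ℝ) (K : ℝ → ℝ → ℝ), MonotoneOn Φ (Iio 0) ∧
      (∀ τ < 0, 0 ≤ Φ τ) ∧
      ∀ (L : ℕ) (ε c : ℝ) (R : EuclideanSpace ℝ (Fin 3) ≃ₗᵢ[ℝ] EuclideanSpace ℝ (Fin 3))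
        (u : ℝ → EuclideanSpace ℝ (Fin 3) → EuclideanSpace ℝ (Fin 3))
        (p : ℝ → EuclideanSpace ℝ (Fin 3) → ℝ)
        (d : ℝ → EuclideanSpace ℝ (Fin 3) → EuclideanSpace ℝ (Fin 3)),
        AngularLadder.IsWindowProfile L C₀ cmin cmax δ ε c R u p d → 0 ≤ ε →
          ∀ s t : ℝ, s < t → t < 0 → ∀ x,
            ‖u t x - UnboundedOperators.heatExtension (u s) (t - s) x + oseenDuhamel 1 s u u t x‖ ≤
                ε * K s t ∧
              (t - s ≤ 1 →
                ‖u t x - UnboundedOperators.heatExtension (u s) (t - s) x + oseenDuhamel 1 s u u t x‖ ≤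
                  ε * Φ t * Real.sqrt (t - s))) :
    Summit.NavierStokesRegularity.NavierStokesRegularity.Theses.AngularGalerkinLadder.LimitTransfer := by
  intro C₀ cmin cmax δ L ε c R u p d hcmin hδ hε hW
  -- window data
  have hcmem : ∀ n, c n ∈ Icc cmin cmax := fun n => ⟨(hW n).2.1, (hW n).2.2.1⟩
  have hprof : ∀ n, AngularLadder.IsRungProfile (L n) C₀ (c n) (R n) (u n) (p n) (d n) :=
    fun n => (hW n).1
  have hcl : ∀ n, IsClassicalNSSolutionOn (Iio 0) 1 (d n) (u n) (p n) := fun n => (hprof n).classical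
  have hTI : ∀ n, HasTypeIDecay C₀ (u n) := fun n => (hprof n).hasTypeIDecay
  have hdss : ∀ n, IsRotatedDSS (c n) (R n) (u n) := fun n => (hprof n).isRotatedDSS
  have hdef : ∀ n, AngularLadder.HasDefectBound (ε n) (d n) := fun n => (hW n).2.2.2.2
  have hamp : ∀ n, ∃ x, δ ≤ ‖u n (-1) x‖ := fun n => (hW n).2.2.2.1
  have hucont : ∀ n, ContinuousOn (uncurry (u n)) (Iio 0 ×ˢ univ) := fun n =>
    (hcl n).smooth_velocity.continuousOn
  -- the constants are nonnegative (the spaces are inhabited)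
  have hC₀ : 0 ≤ C₀ := by
    have h1 := (norm_nonneg _).trans (hTI 0 (-1) (by norm_num) 0)
    simpa using h1
  have hε0 : ∀ n, 0 ≤ ε n := fun n => by
    have h1 := (norm_nonneg _).trans (hdef n (-1) (by norm_num) 0)
    have h2 : (0 : ℝ) < (‖(0 : EuclideanSpace ℝ (Fin 3))‖ + Real.sqrt (-(-1 : ℝ))) ^ 3 := by simp
    exact (div_nonneg_iff.1 h1).elim (fun h => h.1) fun h => absurd h.2 (not_le.2 h2)
  obtain ⟨M, hM⟩ : ∃ M : ℝ, ∀ n, ε n ≤ M := by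
    obtain ⟨b, hb⟩ := hε.bddAbove_range
    exact ⟨b, fun n => hb ⟨n, rfl⟩⟩
  have hM0 : 0 ≤ M := (hε0 0).trans (hM 0)
  obtain ⟨Φ, K, hΦmono, hΦ0, hrem⟩ := hA C₀ cmin cmax δ
  -- Step 1: the window parameters converge along `φ₁`
  obtain ⟨φ₁, c', R', hφ₁, -, hc1, hR1⟩ := exists_subseq_window_tendsto hcmem R
  -- Step 2: the forced KNSS engine along `φ₁`
  have key := exists_oseenMild_limit_of_forced (E := EuclideanSpace ℝ (Fin 3))
    (A := fun k : ℕ => -((k : ℝ) + 1)) (w := fun k => u (φ₁ k))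
    (G := fun k s t x => u (φ₁ k) t x - UnboundedOperators.heatExtension (u (φ₁ k) s) (t - s) x +
      oseenDuhamel 1 s (u (φ₁ k)) (u (φ₁ k)) t x)
    (β := fun τ => C₀ / Real.sqrt (-τ)) (γ := fun τ => M * Φ τ)
    (by
      refine tendsto_atTop_atBot.2 fun b => ⟨Nat.ceil (-b), fun k hk => ?_⟩
      have h1 : -b ≤ (Nat.ceil (-b) : ℝ) := Nat.le_ceil _
      have h2 : (Nat.ceil (-b) : ℝ) ≤ k := by exact_mod_cast hk
      show -((k : ℝ) + 1) ≤ b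
      linarith)
    (monotoneOn_typeI_profile' hC₀)
    (fun a ha b hb hab => mul_le_mul_of_nonneg_left (hΦmono ha hb hab) hM0)
    (fun τ hτ => mul_nonneg hM0 (hΦ0 τ hτ))
    (fun k => (hucont (φ₁ k)).mono (prod_mono (fun t ht => ht.2) Subset.rfl))
    (fun k t ht => VectorCalculus.IsDivFree.isWeaklyDivFree_holds ((hcl (φ₁ k)).divFree t ht.2)
      (contDiff_infty.1 ((hcl (φ₁ k)).contDiff_velocity ht.2) 1))
    (fun k s t _ _ _ x => by abel)
    (fun k s t _ hst ht hlag x => by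
      have h1 := ((hrem (L (φ₁ k)) (ε (φ₁ k)) (c (φ₁ k)) (R (φ₁ k)) (u (φ₁ k)) (p (φ₁ k)) (d (φ₁ k))
        (hW (φ₁ k)) (hε0 (φ₁ k)) s t hst ht x).2 hlag)
      calc _ ≤ ε (φ₁ k) * Φ t * Real.sqrt (t - s) := h1
        _ ≤ M * Φ t * Real.sqrt (t - s) :=
            mul_le_mul_of_nonneg_right (mul_le_mul_of_nonneg_right (hM (φ₁ k)) (hΦ0 t ht))
              (Real.sqrt_nonneg _))
    (fun s t hst ht x => by
      have hb : ∀ k, ‖u (φ₁ k) t x - UnboundedOperators.heatExtension (u (φ₁ k) s) (t - s) x +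
          oseenDuhamel 1 s (u (φ₁ k)) (u (φ₁ k)) t x‖ ≤ ε (φ₁ k) * K s t := fun k =>
        (hrem (L (φ₁ k)) (ε (φ₁ k)) (c (φ₁ k)) (R (φ₁ k)) (u (φ₁ k)) (p (φ₁ k)) (d (φ₁ k))
          (hW (φ₁ k)) (hε0 (φ₁ k)) s t hst ht x).1
      have h0 : Tendsto (fun k => ε (φ₁ k) * K s t) atTop (𝓝 0) := by
        simpa using (hε.comp hφ₁.tendsto_atTop).mul_const (K s t)
      exact squeeze_zero_norm hb h0)
    (fun k τ hτ x => by
      have h1 := hTI (φ₁ k) τ hτ.2 x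
      have hpos : 0 < Real.sqrt (-τ) := Real.sqrt_pos.2 (by linarith [hτ.2])
      exact h1.trans (div_le_div_of_nonneg_left hC₀ hpos (by linarith [norm_nonneg x])))
  obtain ⟨φ₂, W, hφ₂, hWcont, hWdiv, -, hWmild, -, hptw, hloc⟩ := key
  -- Step 3: the cutoff field `v = W` on `t < 0`, `0` on `t ≥ 0`
  set v : ℝ → EuclideanSpace ℝ (Fin 3) → EuclideanSpace ℝ (Fin 3) :=
    fun t => if t < 0 then W t else 0 with hvdef
  have hveq : ∀ t < 0, v t = W t := fun t ht => by simp only [hvdef, if_pos ht]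
  have hv0 : ∀ t, 0 ≤ t → v t = 0 := fun t ht => by simp only [hvdef, if_neg (not_lt.2 ht)]
  have hvcont : ContinuousOn (uncurry v) (Iio 0 ×ˢ univ) :=
    hWcont.congr fun z hz => by
      change v z.1 z.2 = W z.1 z.2
      rw [hveq z.1 (mem_prod.1 hz).1]
  have hvdiv : ∀ t < 0, IsWeaklyDivFree (v t) := fun t ht => by
    rw [hveq t ht]
    exact hWdiv t ht
  have hvmild : ∀ s t : ℝ, s < t → t < 0 → ∀ x,
      v t x = UnboundedOperators.heatExtension (v s) (t - s) x - oseenDuhamel 1 s v v t x := by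
    intro s t hst ht x
    rw [hveq t ht, hveq s (hst.trans ht),
      oseenDuhamel_congr' (fun τ hτ => hveq τ (hτ.2.trans ht)) (fun τ hτ => hveq τ (hτ.2.trans ht))]
    exact hWmild s t hst ht x
  -- Step 4: pointwise and slice convergence to `v`; the Type-I weight passes to the limit
  have hptw' : ∀ t < 0, ∀ x, Tendsto (fun n => u (φ₁ (φ₂ n)) t x) atTop (𝓝 (v t x)) :=
    fun t ht x => by
      rw [hveq t ht]
      exact hptw t ht x
  have hloc1 : TendstoLocallyUniformly (fun n => u (φ₁ (φ₂ n)) (-1)) (v (-1)) atTop := by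
    rw [hveq (-1) (by norm_num)]
    exact hloc (-1) (by norm_num)
  have hvTI : HasTypeIDecay C₀ v := fun t ht x =>
    le_of_tendsto (hptw' t ht x).norm (Eventually.of_forall fun j => hTI (φ₁ (φ₂ j)) t ht x)
  -- Step 5: `v` is a Type-I ancient mild field (KNSS smoothing inside the tree theorem)
  have hTAM : IsTypeIAncientMild C₀ v :=
    LocalTypeIBlowup.isTypeIAncientMild_of_continuous_oseenMild_rate hvcont hvdiv hvmild
      (hvTI.hasTypeITimeDecay hC₀)
  -- Step 6: rotated-DSS structure, measurability, non-triviality (lit g13's Baire/Osgood theorem)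
  obtain ⟨hc', hDSS, -, hmeas, -, hnz⟩ :=
    typeI_rotatedDSS_structure_of_tendsto (μ := (volume : Measure (EuclideanSpace ℝ (Fin 3))))
      hcmin hδ (fun n => (hcmem (φ₁ (φ₂ n))).1) (hc1.comp hφ₂.tendsto_atTop)
      (fun x => (hR1 x).comp hφ₂.tendsto_atTop) (fun n => hdss (φ₁ (φ₂ n)))
      (fun n => hTI (φ₁ (φ₂ n))) (fun n => hucont (φ₁ (φ₂ n))) (fun n => hamp (φ₁ (φ₂ n)))
      hvcont hv0 hptw' hloc1
  exact ⟨c', R', v, hc', hTAM.isAncientMildSolution, hmeas, hDSS, ⟨C₀, hvTI⟩, hnz⟩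

/-- **K3 `LimitTransfer` from the remainder bound in its LITERATURE-SHAPED form** (the hypothesis
quantified over all classical forced solutions on the past with Type-I decay and an `ε`-weighted force,
`Φ`, `K` depending on the Type-I constant only — the shape in which the analytic brick is expected to
be proved; band-limitation, the window and the DSS structure are not used by it): for every `C₀` there
are `Φ` (monotone, `≥ 0` on `(−∞,0)`) and `K` with
`‖u t x − e^{(t−s)Δ}(u s) x + B¹_s(u,u)(t) x‖ ≤ ε·K s t` (and `≤ ε·Φ t·√(t−s)` for `t − s ≤ 1`) for all
`s < t < 0`, whenever `(u, p)` solves Navier–Stokes (`ν = 1`) on `(−∞,0)` classically with force `d`,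
`‖u(t,x)‖ ≤ C₀/(‖x‖ + √−t)` and `‖d(t,x)‖ ≤ ε/(‖x‖ + √−t)³`, `0 ≤ ε`.
[cite: KochNadirashviliSereginSverak2009, Lemma 3.1 and Lemma 6.1 (arXiv:0709.3599)] -/
theorem angularGalerkinLadder_limitTransfer_of_remainder'
    (hA : ∀ C₀ : ℝ, ∃ (Φ : ℝ → ℝ) (K : ℝ → ℝ → ℝ), MonotoneOn Φ (Iio 0) ∧ (∀ τ < 0, 0 ≤ Φ τ) ∧
      ∀ (ε : ℝ) (u : ℝ → EuclideanSpace ℝ (Fin 3) → EuclideanSpace ℝ (Fin 3))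
        (p : ℝ → EuclideanSpace ℝ (Fin 3) → ℝ)
        (d : ℝ → EuclideanSpace ℝ (Fin 3) → EuclideanSpace ℝ (Fin 3)),
        IsClassicalNSSolutionOn (Iio 0) 1 d u p → HasTypeIDecay C₀ u →
          (∀ t < 0, ∀ x, ‖d t x‖ ≤ ε / (‖x‖ + Real.sqrt (-t)) ^ 3) → 0 ≤ ε →
            ∀ s t : ℝ, s < t → t < 0 → ∀ x,
              ‖u t x - UnboundedOperators.heatExtension (u s) (t - s) x + oseenDuhamel 1 s u u t x‖ ≤
                  ε * K s t ∧
                (t - s ≤ 1 →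
                  ‖u t x - UnboundedOperators.heatExtension (u s) (t - s) x + oseenDuhamel 1 s u u t x‖ ≤
                    ε * Φ t * Real.sqrt (t - s))) :
    Summit.NavierStokesRegularity.NavierStokesRegularity.Theses.AngularGalerkinLadder.LimitTransfer := by
  refine angularGalerkinLadder_limitTransfer_of_remainder fun C₀ cmin cmax δ => ?_
  obtain ⟨Φ, K, hΦ, hΦ0, h⟩ := hA C₀
  refine ⟨Φ, K, hΦ, hΦ0, fun L ε c R u p d hW hε => ?_⟩
  exact h ε u p d hW.isRungProfile.classical hW.isRungProfile.hasTypeIDecay hW.2.2.2.2 hε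

end Summit.NavierStokesRegularity.NavierStokesRegularity.Theorems
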